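import Summits.BirchSwinnertonDyer.BirchSwinnertonDyer.Theorems.EisensteinPrimesResidualDevissageFiniteKernel
import Literature.NumberTheory.EllipticCurves.TwoVariableControlLocalKernelProofs
import HarnessLib

/-!
# Crux O2 `BDPSelmerLowerDivisibilityAtTwo` (stmt-BirchSwinnertonDyer-24728), line of record v7
# `two_variable_gv_squeeze_two` (0dcdfdc8ec98ae85), stub P5 `stub_eisensteinDevissage`: the RESIDUAL DÉVISSAGE for
# Greenberg–Vatsal's datum Selmer group of Castella's data (INERTIA condition above the strict prime `𝔭`)

Cell `bsd-2adic`, seat `bsd-2adic-conv-1` GEN 40 (`--supports stmt-BirchSwinnertonDyer-24728`, helper). THEOREMS ONLY: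
no definition, no named fact, no instance, no `sorry`; nothing about any elliptic curve's `L`-function is asserted;
O2 / 19556 / 19218 stay OPEN; BSD is proved for no curve by this file.

## What

The v7 stub P5 (`EisensteinDevissageAt W K`, seat 2's `Lines/split_prime_line_finite_two.lean`) bounds the `2`-torsion
of `datumSelmerInfty κ₂ E_K[2^∞] (Castella2018.AcSelmer.bdpData _ 2 v̄) ∅` — Greenberg–Vatsal's datum Selmer group
(`GreenbergVatsal2000.datumSelmer`): UNRAMIFIED (restriction to `H ⊓ I_w` vanishes, all conjugates) at the finite
`w ∉ S₀`, `w ∤ p`, Greenberg's INERTIA condition for Castella's strict datum above `𝔭 = v̄` (again `res_{H ⊓ I_𝔭} = 0`,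
`mem_greenbergKer_strictDatum_iff_resOfLe_eq_zero`), nothing above the other primes over `p` (relaxed datum) —
by the same group for the trivial module, along `0 → 𝟙 → E[2] → 𝟙 → 0`.  The cell `bsd-eis` proved the
corresponding dévissage for Castella's STRICT group `datumStrictSelmer` (DECOMPOSITION group at `𝔭`;
`ResidualDevissageFiniteKernel.finite_datumStrictSelmer_of_devissage_of_finite`, CGLS 2022 Prop. 17 without the
non-anomalous clause).  This file is the INERTIA-AT-`𝔭` twin, for ANY number field `K`, ANY `ℤ_p`-extension `κ`
(`H = ker κ`), ANY prime `p`, ANY finite-or-not `S₀`, ANY `𝔭 ∋ p` finitely decomposed in `K_∞` (`D_𝔭 ⊄ ker κ`):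

* §1 `forall_resOfLe_inf_inertia_conjH1_eq_zero_of_reps` — representatives for the places of `K_∞` above `𝔭` in
  the INERTIA currency: the conditions `res_{H ⊓ I_𝔭}(conj_σ x) = 0` for ALL `σ ∈ Γ_K` follow from those at `σ = τ i`,
  `κ(τ i) = i`, `i < p^c` (the tree's `UniversalToricDescentResidualSelmerFinite.forall_resOfLe_conjH1_eq_zero_of_reps`
  with `D_𝔭` replaced by `I_𝔭`, through tower-1's conjugation invariance `resOfLe_inf_inertia_conjH1_eq_zero_iff`);
* §2 `mem_datumSelmer_bdpData_iff` — membership in `S^{S₀}_M(K̄^H)` for Castella's data as plain restrictions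
  (`res_{H ⊓ I_w}(conj_σ c) = 0` at `w ∉ S₀`, `w ∤ p`, and at `w = 𝔭`); `resH1Hom_id_mem_datumSelmer_bdpData` — a
  `Γ_K`-equivariant map of coefficients maps `S^{S₀}_M` into `S^{S₀}_{M'}`;
* §3 **`finite_preimage_datumSelmer_of_finite_ker`** — for `j : A → B` equivariant with `j_*` injective on
  `H¹(H ⊓ I_w, ·)` at the good `w ∉ S₀` (U) and FINITE kernel on `H¹(H ⊓ I_𝔭, ·)`: `S^{S₀}_A` finite ⟹
  `j_*⁻¹ S^{S₀}_B` finite (the signature argument of Lim–Sujatha / Greenberg §3 at the places above `𝔭`);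
* §4 **`finite_datumSelmer_of_devissage_of_finite`** (+ `…_of_unramified`) — for an equivariant exact
  `0 → A → B → C → 0` with `C` finite: `S^{S₀}_A` finite ∧ `S^{S₀}_C` finite ⟹ `S^{S₀}_B` finite.

References: [CastellaGrossiLeeSkinner2022] §1.4 Prop. 17; [LimSujatha2018] §3 Prop. 3.2; [GreenbergLNM1716] §3 Lemmas 3.1–3.3;
[GreenbergVatsal2000] §2 pp. 16–17, 20; [Greenberg1989] §1 p. 98 (4); [SerreGaloisCohomology1997] I §2.2, §2.5, §5.
-/

set_option autoImplicit false
-- D-0017: the summit and its sub-problem share the name `BirchSwinnertonDyer`.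
set_option linter.dupNamespace false

noncomputable section

open scoped Classical

namespace Summit.BirchSwinnertonDyer.BirchSwinnertonDyer.Theorems.TwoAdicBDPEisensteinDevissage

open NumberField IsDedekindDomain Field
open Literature.NumberTheory.EllipticCurves Literature.NumberTheory.EllipticCurves.GreenbergSelmer
  Literature.NumberTheory.EllipticCurves.GreenbergVatsal2000
  Literature.NumberTheory.EllipticCurves.FineSelmerCoefficientMap
  Literature.NumberTheory.GaloisRepresentations
  Summit.BirchSwinnertonDyer.BirchSwinnertonDyer.Theorems.UniversalToricDescentResidualSelmer
  Summit.BirchSwinnertonDyer.BirchSwinnertonDyer.Theorems.CumulativeHeegnerInclusionAtThreeStubB1Devissage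
  Summit.BirchSwinnertonDyer.BirchSwinnertonDyer.Theorems.CumulativeHeegnerInclusionAtThreeStubB1DevissageNamed
  Summit.BirchSwinnertonDyer.BirchSwinnertonDyer.Theorems.ResidualDevissageFiniteKernel

/-! ### §1 Representatives for the places of `K_∞` above a finitely decomposed place, INERTIA currency -/

section Reps

variable {K : Type} [Field K] [NumberField K] {p : ℕ} [Fact p.Prime] {κ : ZpExtension K p}

/-- **Representatives for the places of `K_∞` above `v` (`D_v ⊄ ker κ`), inertia currency.** There is `c` such that,
for any elements `τ i` with `κ(τ i) = i` (`i < p^c`), the conditions «`res_{H ⊓ I_v}(conj_σ x) = 0`» for ALL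
`σ ∈ Γ_K` follow from those for `σ = τ i`, `i < p^c`: `κ(D_v)` is closed and contains some `κ(δ) ≠ 1`, hence
`⊇ p^c ℤ_p`, so every `σ` is `δ · τ i · h` with `δ ∈ D_v`, `h ∈ ker κ`; `conj_h = id` (`conjH1_of_mem_holds`) and
`conj_δ` preserves the condition because `D_v` normalises `I_v` (`resOfLe_inf_inertia_conjH1_eq_zero_iff`).
[cite: GreenbergLNM1716, §3 (p. 85: the places of `F_n` lying over `v`)] [cite: SerreGaloisCohomology1997, I §2.5] -/
theorem forall_resOfLe_inf_inertia_conjH1_eq_zero_of_reps {M : Type} [AddCommGroup M]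
    [DistribMulAction (absoluteGaloisGroup K) M] [TopologicalSpace M] [DiscreteTopology M]
    (v : HeightOneSpectrum (𝓞 K)) (hv : ¬ (decomp v ≤ κ.kerSubgroup)) :
    ∃ c : ℕ, ∀ (τ : ℕ → absoluteGaloisGroup K),
      (∀ i, κ (τ i) = Multiplicative.ofAdd ((i : ℕ) : ℤ_[p])) →
      ∀ x : Literature.NumberTheory.EllipticCurves.subgroupH1 κ.kerSubgroup M,
        (∀ i, i < p ^ c → resOfLe M (inf_le_left : κ.kerSubgroup ⊓ inertia v ≤ κ.kerSubgroup)
          (Literature.NumberTheory.EllipticCurves.conjH1 κ.kerSubgroup M (τ i) x) = 0) →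
        ∀ σ : absoluteGaloisGroup K,
          resOfLe M (inf_le_left : κ.kerSubgroup ⊓ inertia v ≤ κ.kerSubgroup)
            (Literature.NumberTheory.EllipticCurves.conjH1 κ.kerSubgroup M σ x) = 0 := by
  -- the closed subgroup `κ(D_v)` and a non-zero element `u` in it
  obtain ⟨δv, hδvD, hδv⟩ : ∃ δ ∈ decomp v, δ ∉ κ.kerSubgroup := Set.not_subset.mp hv
  rw [ZpExtension.mem_kerSubgroup] at hδv
  set u : ℤ_[p] := (κ δv).toAdd with hudef
  have hu0 : u ≠ 0 := fun h ↦ hδv (Multiplicative.toAdd.injective h)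
  let Z : AddSubgroup ℤ_[p] :=
    AddSubgroup.toSubgroup.symm ((decomp v).map
      (κ.toContinuousMonoidHom : absoluteGaloisGroup K →* Multiplicative ℤ_[p]))
  have hZmem : ∀ y : ℤ_[p], y ∈ Z ↔ ∃ δ ∈ decomp v, κ δ = Multiplicative.ofAdd y := fun y ↦ by
    change Multiplicative.ofAdd y ∈ (decomp v).map _ ↔ _
    rw [Subgroup.mem_map]
    rfl
  have hZclosed : IsClosed (Z : Set ℤ_[p]) := by
    have hc : IsCompact (((decomp v).map
        (κ.toContinuousMonoidHom : absoluteGaloisGroup K →* Multiplicative ℤ_[p]) :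
        Subgroup (Multiplicative ℤ_[p])) : Set (Multiplicative ℤ_[p])) := by
      rw [Subgroup.coe_map]
      exact (Kobayashi2003.isCompact_decomp v).image κ.toContinuousMonoidHom.continuous
    exact hc.isClosed
  have huZ : u ∈ Z := (hZmem u).mpr ⟨δv, hδvD, rfl⟩
  refine ⟨u.valuation, fun τ hτ x hx σ ↦ ?_⟩
  set c := u.valuation with hc
  -- write `κ σ = i + p^c z`, `i < p^c`
  set y : ℤ_[p] := (κ σ).toAdd with hy
  set i : ℕ := (PadicInt.toZModPow c y).val with hi
  have hi_lt : i < p ^ c := ZMod.val_lt _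
  have hyi : y - i ∈ Ideal.span {(p : ℤ_[p]) ^ c} := by
    rw [← PadicInt.ker_toZModPow, RingHom.mem_ker, map_sub, map_natCast, hi, ZMod.natCast_zmod_val,
      sub_self]
  obtain ⟨z, hz⟩ := Ideal.mem_span_singleton.mp hyi
  -- `p^c z ∈ κ(D_v)`: `y - i = κ δ`
  obtain ⟨δ, hδD, hδ⟩ := (hZmem _).mp (hz ▸ pow_valuation_mul_mem_of_isClosed Z hZclosed huZ hu0 z :
    y - i ∈ Z)
  -- `h = (δ τ_i)⁻¹ σ ∈ ker κ`
  have hh : (δ * τ i)⁻¹ * σ ∈ κ.kerSubgroup := by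
    rw [ZpExtension.mem_kerSubgroup, map_mul, map_inv, map_mul, hδ, hτ i]
    apply Multiplicative.toAdd.injective
    rw [toAdd_mul, toAdd_inv, toAdd_mul, toAdd_ofAdd, toAdd_ofAdd, toAdd_one, ← hy]
    ring
  have hσ : σ = δ * (τ i * ((δ * τ i)⁻¹ * σ)) := by group
  rw [hσ, Literature.NumberTheory.EllipticCurves.conjH1_mul_holds, AddMonoidHom.comp_apply,
    Literature.NumberTheory.EllipticCurves.conjH1_mul_holds, AddMonoidHom.comp_apply,
    Literature.NumberTheory.EllipticCurves.conjH1_of_mem_holds κ.kerSubgroup M hh,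
    AddMonoidHom.id_apply]
  exact (resOfLe_inf_inertia_conjH1_eq_zero_iff κ.kerSubgroup v hδD _).mpr (hx i hi_lt)

end Reps

/-! ### §2 Membership in `S^{S₀}_M(K̄^H)` for Castella's data, as plain restrictions; functoriality -/

section Membership

variable {K : Type} [Field K] [NumberField K] (H : Subgroup (absoluteGaloisGroup K)) [H.Normal] (p : ℕ)
  {𝔭 : HeightOneSpectrum (𝓞 K)} (S₀ : Set (HeightOneSpectrum (𝓞 K)))
variable {M : Type} [AddCommGroup M] [DistribMulAction (absoluteGaloisGroup K) M] [TopologicalSpace M]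
  [DiscreteTopology M]
variable {M' : Type} [AddCommGroup M'] [DistribMulAction (absoluteGaloisGroup K) M'] [TopologicalSpace M']
  [DiscreteTopology M']

/-- **Membership in Greenberg–Vatsal's `S^{S₀}_M(K̄^H)` for Castella's data `bdpData M p 𝔭` as plain restrictions**:
`c` belongs to it iff (i) `res_{H ⊓ I_w}(conj_σ c) = 0` for every finite `w ∉ S₀` with `w ∤ p` and every `σ ∈ Γ_K`
(UNRAMIFIED at every place of `K̄^H` above `w`, `mem_unramifiedKer_iff_resOfLe_eq_zero`) and (ii)
`res_{H ⊓ I_𝔭}(conj_σ c) = 0` for every `σ` (Greenberg's INERTIA condition for the strict datum `M⁺_𝔭 = 0`,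
`mem_greenbergKer_strictDatum_iff_resOfLe_eq_zero`); above the other primes over `p` the datum is relaxed and the
condition vacuous (`greenbergKer_relaxedDatum_eq_top`). [cite: GreenbergVatsal2000, §2 pp. 16–17, 20]
[cite: Castella2018, Def. 2.2 (arXiv:1704.06608 p. 5)] [cite: Greenberg1989, §1 p. 98 (4)] -/
theorem mem_datumSelmer_bdpData_iff (h𝔭 : ((p : ℕ) : 𝓞 K) ∈ 𝔭.asIdeal) (c : subgroupH1 H M) :
    c ∈ datumSelmer H M p (Castella2018.AcSelmer.bdpData M p 𝔭) S₀ ↔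
      (∀ w : HeightOneSpectrum (𝓞 K), w ∉ S₀ → ((p : ℕ) : 𝓞 K) ∉ w.asIdeal →
        ∀ σ : absoluteGaloisGroup K,
          resOfLe M (inf_le_left : H ⊓ inertia w ≤ H) (conjH1 H M σ c) = 0) ∧
      ∀ σ : absoluteGaloisGroup K, resOfLe M (inf_le_left : H ⊓ inertia 𝔭 ≤ H) (conjH1 H M σ c) = 0 := by
  rw [mem_datumSelmer_iff, mem_unramifiedOutside_iff]
  refine and_congr (forall₄_congr fun w _ _ σ ↦ mem_unramifiedKer_iff_resOfLe_eq_zero H w _) ⟨?_, ?_⟩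
  · intro h σ
    have h1 := h 𝔭 h𝔭 σ
    rw [Castella2018.AcSelmer.bdpData_self p 𝔭 h𝔭, mem_greenbergKer_strictDatum_iff_resOfLe_eq_zero] at h1
    exact h1
  · intro h w hw σ
    by_cases hw𝔭 : w = 𝔭
    · subst hw𝔭
      rw [Castella2018.AcSelmer.bdpData_self p w hw, mem_greenbergKer_strictDatum_iff_resOfLe_eq_zero]
      exact h σ
    · rw [Castella2018.AcSelmer.bdpData_of_ne p 𝔭 hw hw𝔭, greenbergKer_relaxedDatum_eq_top]
      exact AddSubgroup.mem_top _

/-- **A `Γ_K`-equivariant map of coefficients `ψ : M → M'` maps `S^{S₀}_M(K̄^H)` into `S^{S₀}_{M'}(K̄^H)`** (Castella's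
data, Greenberg's inertia condition at `𝔭`): every defining condition is «a restriction of a conjugate vanishes» (§2),
and `ψ_*` commutes with conjugation (`conjH1_comp_resH1Hom_id`) and restriction (`resOfLe_comp_resH1Hom_id`).
[cite: GreenbergVatsal2000, §2 p. 26] [cite: LimSujatha2018, §3 (functoriality of `R_S(·/𝓛)`)] -/
theorem resH1Hom_id_mem_datumSelmer_bdpData (h𝔭 : ((p : ℕ) : 𝓞 K) ∈ 𝔭.asIdeal) (ψ : M →+ M')
    (hψ' : ∀ (g : absoluteGaloisGroup K) (m : M), ψ (g • m) = g • ψ m)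
    (hψH : ∀ (x : H) (m : M), ψ (ContinuousMonoidHom.id H x • m) = x • ψ m)
    {c : subgroupH1 H M} (hc : c ∈ datumSelmer H M p (Castella2018.AcSelmer.bdpData M p 𝔭) S₀) :
    resH1Hom (ContinuousMonoidHom.id H) ψ hψH c ∈
      datumSelmer H M' p (Castella2018.AcSelmer.bdpData M' p 𝔭) S₀ := by
  rw [mem_datumSelmer_bdpData_iff H p S₀ h𝔭] at hc ⊢
  have hconj : ∀ σ : absoluteGaloisGroup K,
      conjH1 H M' σ (resH1Hom (ContinuousMonoidHom.id H) ψ hψH c) =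
        resH1Hom (ContinuousMonoidHom.id H) ψ hψH (conjH1 H M σ c) :=
    fun σ ↦ congrArg (fun f : subgroupH1 H M →+ subgroupH1 H M' ↦ f c)
      (conjH1_comp_resH1Hom_id H ψ hψH hψ' σ)
  have hres : ∀ (H₁ : Subgroup (absoluteGaloisGroup K)) (hle : H₁ ≤ H) (x : subgroupH1 H M),
      resOfLe M' hle (resH1Hom (ContinuousMonoidHom.id H) ψ hψH x) =
        resH1Hom (ContinuousMonoidHom.id H₁) ψ (fun y m ↦ hψ' _ m) (resOfLe M hle x) := fun H₁ hle x ↦ by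
    have e := congrArg (fun f : subgroupH1 H M →+ subgroupH1 H₁ M' ↦ f x)
      (resOfLe_comp_resH1Hom_id hle ψ hψH (fun y m ↦ hψ' _ m))
    simpa only [AddMonoidHom.comp_apply] using e
  refine ⟨fun w hw hwp σ ↦ ?_, fun σ ↦ ?_⟩
  · rw [hconj, hres, hc.1 w hw hwp σ, map_zero]
  · rw [hconj, hres, hc.2 σ, map_zero]

/-- `S^{S₀}_M ≤ S^{S₁}_M` for `S₀ ⊆ S₁` (Castella data; re-export of the tree's `datumSelmer_mono` in the shape used below).
[cite: GreenbergVatsal2000, §2 p. 20] -/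
theorem datumSelmer_bdpData_mono {S₁ : Set (HeightOneSpectrum (𝓞 K))} (h : S₀ ⊆ S₁) :
    datumSelmer H M p (Castella2018.AcSelmer.bdpData M p 𝔭) S₀ ≤
      datumSelmer H M p (Castella2018.AcSelmer.bdpData M p 𝔭) S₁ :=
  datumSelmer_mono H M p _ h

end Membership

/-! ### §3 The signature argument: `j_*⁻¹ S^{S₀}_B` is finite when `S^{S₀}_A` is -/

section Residual

variable {K : Type} [Field K] [NumberField K] {p : ℕ} [Fact p.Prime] (κ : ZpExtension K p)
  (𝔭 : HeightOneSpectrum (𝓞 K)) (S₀ : Set (HeightOneSpectrum (𝓞 K)))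

variable {A : Type} [AddCommGroup A] [DistribMulAction (absoluteGaloisGroup K) A] [TopologicalSpace A]
  [DiscreteTopology A]
variable {B : Type} [AddCommGroup B] [DistribMulAction (absoluteGaloisGroup K) B] [TopologicalSpace B]
  [DiscreteTopology B]
variable {C : Type} [AddCommGroup C] [DistribMulAction (absoluteGaloisGroup K) C] [TopologicalSpace C]
  [DiscreteTopology C]

/-- **`j_*⁻¹ S^{S₀}_B(K_∞)` is finite when `S^{S₀}_A(K_∞)` is** (Castella data, Greenberg's INERTIA condition above
`𝔭`). Setting: `H = ker κ`, `𝔭 ∋ p` with `D_𝔭 ⊄ ker κ`, `j : A → B` `Γ_K`-equivariant with `j_*` injective on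
`H¹(H ⊓ I_w, ·)` at the good `w ∉ S₀` (U) and with FINITE kernel `T` on `H¹(H ⊓ I_𝔭, ·)`. With representatives `τ i`
(§1) the signature `Ψ x = (res_{H ⊓ I_𝔭} conj_{τ i} x)_{i < p^c}` sends `j_*⁻¹ S(B)` into `T^{p^c}` (naturality of
`j_*`), and its kernel there lies in `S(A)` ((U) at the good places, §1 above `𝔭`); a map with finite kernel and
finite image on a subgroup has finite source (`AddMonoidHom.finite_preimage_of_finite_ker`).
[cite: LimSujatha2018, §3 (proof of Prop. 3.2)] [cite: GreenbergLNM1716, §3 (Lemmas 3.1–3.3)]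
[cite: CastellaGrossiLeeSkinner2022, Prop. 17 (arXiv:2008.02571 §1.4)] -/
theorem finite_preimage_datumSelmer_of_finite_ker (h𝔭 : ((p : ℕ) : 𝓞 K) ∈ 𝔭.asIdeal)
    (h𝔭dec : ¬ (decomp 𝔭 ≤ κ.kerSubgroup))
    (j : A →+ B) (hj' : ∀ (σ : absoluteGaloisGroup K) (a : A), j (σ • a) = σ • j a)
    (hU : ∀ w : HeightOneSpectrum (𝓞 K), w ∉ S₀ → ((p : ℕ) : 𝓞 K) ∉ w.asIdeal →
      Function.Injective
        (resH1Hom (ContinuousMonoidHom.id ↥(κ.kerSubgroup ⊓ inertia w)) j (fun _ a ↦ hj' _ a)))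
    (hT : Set.Finite {y : Literature.NumberTheory.EllipticCurves.subgroupH1 (κ.kerSubgroup ⊓ inertia 𝔭) A |
      resH1Hom (ContinuousMonoidHom.id ↥(κ.kerSubgroup ⊓ inertia 𝔭)) j (fun _ a ↦ hj' _ a) y = 0})
    (hA : (datumSelmer κ.kerSubgroup A p (Castella2018.AcSelmer.bdpData A p 𝔭) S₀ :
      Set (Literature.NumberTheory.EllipticCurves.subgroupH1 κ.kerSubgroup A)).Finite) :
    Set.Finite {x : Literature.NumberTheory.EllipticCurves.subgroupH1 κ.kerSubgroup A |
      resH1Hom (ContinuousMonoidHom.id κ.kerSubgroup) j (fun _ a ↦ hj' _ a) x ∈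
        datumSelmer κ.kerSubgroup B p (Castella2018.AcSelmer.bdpData B p 𝔭) S₀} := by
  -- notation
  let H := κ.kerSubgroup
  let jH := resH1Hom (ContinuousMonoidHom.id H) j (fun _ a ↦ hj' _ a)
  have hconj : ∀ (σ : absoluteGaloisGroup K) (x : Literature.NumberTheory.EllipticCurves.subgroupH1 H A),
      conjH1 H B σ (jH x) = jH (conjH1 H A σ x) := fun σ x ↦
    congrArg (fun f : Literature.NumberTheory.EllipticCurves.subgroupH1 H A →+
        Literature.NumberTheory.EllipticCurves.subgroupH1 H B ↦ f x)
      (conjH1_comp_resH1Hom_id H j (fun _ a ↦ hj' _ a) hj' σ)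
  have hres : ∀ (w : HeightOneSpectrum (𝓞 K)) (x : Literature.NumberTheory.EllipticCurves.subgroupH1 H A),
      resOfLe B (inf_le_left : H ⊓ inertia w ≤ H) (jH x) =
        resH1Hom (ContinuousMonoidHom.id ↥(H ⊓ inertia w)) j (fun _ a ↦ hj' _ a)
          (resOfLe A (inf_le_left : H ⊓ inertia w ≤ H) x) := fun w x ↦ by
    have e := congrArg (fun f : Literature.NumberTheory.EllipticCurves.subgroupH1 H A →+
        Literature.NumberTheory.EllipticCurves.subgroupH1 (H ⊓ inertia w) B ↦ f x)
      (resOfLe_comp_resH1Hom_id (inf_le_left : H ⊓ inertia w ≤ H) j (fun _ a ↦ hj' _ a)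
        (fun _ a ↦ hj' _ a))
    simpa only [AddMonoidHom.comp_apply] using e
  -- representatives at `𝔭`
  obtain ⟨c, hc⟩ := forall_resOfLe_inf_inertia_conjH1_eq_zero_of_reps (M := A) (κ := κ) 𝔭 h𝔭dec
  have hτex : ∀ i : ℕ, ∃ τ : absoluteGaloisGroup K, κ τ = Multiplicative.ofAdd ((i : ℕ) : ℤ_[p]) :=
    fun i ↦ κ.surjective _
  choose τ hτ using hτex
  -- the signature map
  let resp : Literature.NumberTheory.EllipticCurves.subgroupH1 H A →+
      Literature.NumberTheory.EllipticCurves.subgroupH1 (H ⊓ inertia 𝔭) A :=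
    resOfLe A (inf_le_left : H ⊓ inertia 𝔭 ≤ H)
  let Ψ : Literature.NumberTheory.EllipticCurves.subgroupH1 H A →+
      (Fin (p ^ c) → Literature.NumberTheory.EllipticCurves.subgroupH1 (H ⊓ inertia 𝔭) A) :=
    { toFun := fun x i ↦ resp (conjH1 H A (τ i) x)
      map_zero' := by ext i; simp
      map_add' := fun x y ↦ by ext i; simp }
  -- `Y = j_*⁻¹ S(B)`
  let Y : AddSubgroup (Literature.NumberTheory.EllipticCurves.subgroupH1 H A) :=
    (datumSelmer H B p (Castella2018.AcSelmer.bdpData B p 𝔭) S₀).comap jH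
  have hYmem : ∀ x, x ∈ Y ↔ jH x ∈ datumSelmer H B p (Castella2018.AcSelmer.bdpData B p 𝔭) S₀ :=
    fun x ↦ Iff.rfl
  -- (a) on `Y`, `Ψ` takes values in the finite kernel `T`
  have hΨker : ∀ x ∈ Y, ∀ i : Fin (p ^ c),
      resH1Hom (ContinuousMonoidHom.id ↥(H ⊓ inertia 𝔭)) j (fun _ a ↦ hj' _ a) (Ψ x i) = 0 := by
    intro x hx i
    change resH1Hom (ContinuousMonoidHom.id ↥(H ⊓ inertia 𝔭)) j (fun _ a ↦ hj' _ a)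
      (resp (conjH1 H A (τ i) x)) = 0
    rw [← hres, ← hconj]
    exact ((mem_datumSelmer_bdpData_iff H p S₀ h𝔭 _).mp ((hYmem x).mp hx)).2 (τ i)
  -- (b) the kernel of `Ψ` on `Y` lies in `S(A)`
  have hΨzero : ∀ x ∈ Y, Ψ x = 0 →
      x ∈ datumSelmer H A p (Castella2018.AcSelmer.bdpData A p 𝔭) S₀ := by
    intro x hx hΨ
    have hxB := (mem_datumSelmer_bdpData_iff H p S₀ h𝔭 _).mp ((hYmem x).mp hx)
    rw [mem_datumSelmer_bdpData_iff H p S₀ h𝔭]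
    refine ⟨fun w hwS hwp σ ↦ ?_, fun σ ↦ ?_⟩
    · -- unramified at the good `w ∉ S₀`: (U)
      have h := hxB.1 w hwS hwp σ
      rw [hconj, hres] at h
      exact (injective_iff_map_eq_zero _).mp (hU w hwS hwp) _ h
    · -- above `𝔭`: all conjugates from the representatives (§1)
      refine hc τ hτ x (fun i hi ↦ ?_) σ
      exact congrFun hΨ ⟨i, hi⟩
  -- (c) `Y` is finite: `Ψ|_Y` has finite kernel and finite target set `T^{p^c}`
  let g : Y →+ (Fin (p ^ c) → Literature.NumberTheory.EllipticCurves.subgroupH1 (H ⊓ inertia 𝔭) A) :=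
    Ψ.comp Y.subtype
  have hgker : ((g.ker : AddSubgroup Y) : Set Y).Finite := by
    have hsub : ((g.ker : AddSubgroup Y) : Set Y) ⊆
        (fun r : Y ↦ (r : Literature.NumberTheory.EllipticCurves.subgroupH1 H A)) ⁻¹'
          (datumSelmer H A p (Castella2018.AcSelmer.bdpData A p 𝔭) S₀ :
            Set (Literature.NumberTheory.EllipticCurves.subgroupH1 H A)) := by
      intro r hr
      exact hΨzero r r.2 ((AddMonoidHom.mem_ker).mp hr)
    exact (hA.preimage Subtype.val_injective.injOn).subset hsub
  let T : Set (Fin (p ^ c) → Literature.NumberTheory.EllipticCurves.subgroupH1 (H ⊓ inertia 𝔭) A) :=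
    Set.pi Set.univ fun _ ↦
      {y : Literature.NumberTheory.EllipticCurves.subgroupH1 (H ⊓ inertia 𝔭) A |
        resH1Hom (ContinuousMonoidHom.id ↥(H ⊓ inertia 𝔭)) j (fun _ a ↦ hj' _ a) y = 0}
  have hTfin : T.Finite := Set.Finite.pi fun _ ↦ hT
  have huniv : (g ⁻¹' T) = Set.univ := by
    ext r
    simp only [Set.mem_preimage, Set.mem_univ, iff_true, T, Set.mem_univ_pi, Set.mem_setOf_eq]
    intro i
    exact hΨker r r.2 i
  have hYuniv : (Set.univ : Set Y).Finite := by
    rw [← huniv]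
    exact AddMonoidHom.finite_preimage_of_finite_ker g hgker hTfin
  have hY : (Y : Set (Literature.NumberTheory.EllipticCurves.subgroupH1 H A)) =
      (fun r : Y ↦ (r : Literature.NumberTheory.EllipticCurves.subgroupH1 H A)) '' Set.univ := by
    ext x
    simp only [SetLike.mem_coe, Set.image_univ, Set.mem_range, Subtype.exists, exists_prop,
      exists_eq_right]
  change (Y : Set (Literature.NumberTheory.EllipticCurves.subgroupH1 H A)).Finite
  rw [hY]; exact hYuniv.image _

/-! ### §4 The dévissage along `0 → A → B → C → 0` with `C` finite -/

/-- **Dévissage: `S^{S₀}_A(K_∞)` and `S^{S₀}_C(K_∞)` finite ⟹ `S^{S₀}_B(K_∞)` finite** (Castella data, Greenberg's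
inertia condition above `𝔭`), for a `Γ_K`-equivariant exact `0 → A —j→ B —q→ C → 0` of discrete `Γ_K`-modules with `C`
FINITE (continuous orbit maps on `B`), `H = ker κ`, `𝔭 ∋ p` finitely decomposed in `K_∞` (`D_𝔭 ⊄ ker κ`) and (U) at
the good places outside `S₀`. The kernel of `j_*` on `H¹(H ⊓ I_𝔭, ·)` is finite because `C` is
(`finite_ker_resH1Hom_id_of_finite`, the connecting homomorphism); then §3 and the middle exactness
`finite_of_finite_image_of_finite_lifts`. No hypothesis on `C` above `𝔭` (anomalous case allowed).
[cite: CastellaGrossiLeeSkinner2022, Prop. 17 (arXiv:2008.02571 §1.4)] [cite: KellerYin2024, Thm. 1.4.1 (arXiv:2402.12781v2 §1.4)]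
[cite: SerreGaloisCohomology1997, I §2.2] -/
theorem finite_datumSelmer_of_devissage_of_finite [Finite C]
    (h𝔭 : ((p : ℕ) : 𝓞 K) ∈ 𝔭.asIdeal) (h𝔭dec : ¬ (decomp 𝔭 ≤ κ.kerSubgroup)) (j : A →+ B)
    (hj' : ∀ (σ : absoluteGaloisGroup K) (a : A), j (σ • a) = σ • j a) (hinj : Function.Injective j)
    (q : B →+ C) (hq' : ∀ (σ : absoluteGaloisGroup K) (b : B), q (σ • b) = σ • q b)
    (hsurj : Function.Surjective q) (hexact : ∀ b : B, q b = 0 → ∃ a : A, j a = b)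
    (hcontB : ∀ b : B, Continuous fun g : absoluteGaloisGroup K ↦ g • b)
    (hU : ∀ w : HeightOneSpectrum (𝓞 K), w ∉ S₀ → ((p : ℕ) : 𝓞 K) ∉ w.asIdeal →
      Function.Injective
        (resH1Hom (ContinuousMonoidHom.id ↥(κ.kerSubgroup ⊓ inertia w)) j (fun _ a ↦ hj' _ a)))
    (hA : (datumSelmer κ.kerSubgroup A p (Castella2018.AcSelmer.bdpData A p 𝔭) S₀ :
      Set (Literature.NumberTheory.EllipticCurves.subgroupH1 κ.kerSubgroup A)).Finite)
    (hC : (datumSelmer κ.kerSubgroup C p (Castella2018.AcSelmer.bdpData C p 𝔭) S₀ :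
      Set (Literature.NumberTheory.EllipticCurves.subgroupH1 κ.kerSubgroup C)).Finite) :
    (datumSelmer κ.kerSubgroup B p (Castella2018.AcSelmer.bdpData B p 𝔭) S₀ :
      Set (Literature.NumberTheory.EllipticCurves.subgroupH1 κ.kerSubgroup B)).Finite := by
  have hcontH : ∀ b : B, Continuous fun g : κ.kerSubgroup ↦ g • b := fun b ↦
    (hcontB b).comp continuous_subtype_val
  refine finite_of_finite_image_of_finite_lifts (G := κ.kerSubgroup) j (fun _ a ↦ hj' _ a) hinj q
    (fun _ b ↦ hq' _ b) hsurj hexact hcontH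
    (datumSelmer κ.kerSubgroup B p (Castella2018.AcSelmer.bdpData B p 𝔭) S₀) ?_ ?_
  · -- the image in `H¹(H, C)` lies in `S(C)`
    refine hC.subset ?_
    rintro _ ⟨c, hc, rfl⟩
    exact resH1Hom_id_mem_datumSelmer_bdpData κ.kerSubgroup p S₀ h𝔭 q hq' (fun _ b ↦ hq' _ b) hc
  · -- the preimage in `H¹(H, A)` is finite: the connecting-homomorphism kernel + the signature argument
    refine finite_preimage_datumSelmer_of_finite_ker κ 𝔭 S₀ h𝔭 h𝔭dec j hj' hU ?_ hA
    exact finite_ker_resH1Hom_id_of_finite (G := ↥(κ.kerSubgroup ⊓ inertia 𝔭)) j (fun _ a ↦ hj' _ a) hinj q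
      hexact

/-- **The same with (U) discharged** by «`H ⊓ I_w` acts trivially on `B` at every `w ∉ S₀`, `w ∤ p`» (unramified
coefficients there — e.g. `B = E[p]` with `S₀ ⊇` the bad places prime to `p`; `resH1Hom_id_injective_of_smul_eq`).
[cite: CastellaGrossiLeeSkinner2022, Prop. 17 (arXiv:2008.02571 §1.4)] [cite: SerreGaloisCohomology1997, I §2.3] -/
theorem finite_datumSelmer_of_devissage_of_finite_of_unramified [Finite C]
    (h𝔭 : ((p : ℕ) : 𝓞 K) ∈ 𝔭.asIdeal) (h𝔭dec : ¬ (decomp 𝔭 ≤ κ.kerSubgroup)) (j : A →+ B)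
    (hj' : ∀ (σ : absoluteGaloisGroup K) (a : A), j (σ • a) = σ • j a) (hinj : Function.Injective j)
    (q : B →+ C) (hq' : ∀ (σ : absoluteGaloisGroup K) (b : B), q (σ • b) = σ • q b)
    (hsurj : Function.Surjective q) (hexact : ∀ b : B, q b = 0 → ∃ a : A, j a = b)
    (hcontB : ∀ b : B, Continuous fun g : absoluteGaloisGroup K ↦ g • b)
    (hunr : ∀ w : HeightOneSpectrum (𝓞 K), w ∉ S₀ → ((p : ℕ) : 𝓞 K) ∉ w.asIdeal →
      ∀ (τ : ↥(κ.kerSubgroup ⊓ inertia w)) (b : B), τ • b = b)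
    (hA : (datumSelmer κ.kerSubgroup A p (Castella2018.AcSelmer.bdpData A p 𝔭) S₀ :
      Set (Literature.NumberTheory.EllipticCurves.subgroupH1 κ.kerSubgroup A)).Finite)
    (hC : (datumSelmer κ.kerSubgroup C p (Castella2018.AcSelmer.bdpData C p 𝔭) S₀ :
      Set (Literature.NumberTheory.EllipticCurves.subgroupH1 κ.kerSubgroup C)).Finite) :
    (datumSelmer κ.kerSubgroup B p (Castella2018.AcSelmer.bdpData B p 𝔭) S₀ :
      Set (Literature.NumberTheory.EllipticCurves.subgroupH1 κ.kerSubgroup B)).Finite := by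
  refine finite_datumSelmer_of_devissage_of_finite κ 𝔭 S₀ h𝔭 h𝔭dec j hj' hinj q hq' hsurj hexact hcontB ?_ hA hC
  intro w hwS hwp
  exact resH1Hom_id_injective_of_smul_eq (G := ↥(κ.kerSubgroup ⊓ inertia w)) j (fun _ a ↦ hj' _ a) hinj
    (hunr w hwS hwp)

end Residual

end Summit.BirchSwinnertonDyer.BirchSwinnertonDyer.Theorems.TwoAdicBDPEisensteinDevissage

end
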